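import Summits.KontsevichZagierPeriods.KontsevichZagierPeriods.Theorems.LinRedNormalFormDihedralNormalFormStubExactToFacesTwoAux
import Literature.NumberTheory.Transcendental.KZProductIdeal

/-!
# Stub `stub_exactToFacesTwo` of line `tame-bv-stokes` (crux `DihedralNormalForm`) — tools II

Support file for the stub `stub_exactToFacesTwo`: the ONE Stokes move of the stub and the
bookkeeping modulo relations. As in tools I we abbreviate, in the docstrings only,
`GEN(k, a, b, P, R, m) = fun x => k x₀^a x₁^b (1-x₀)^P (1-x₁)^R (1-x₀x₁)^m`.

* Face values of `GEN(k, a, b, P, R, m)` on the four sides of the square are rational polynomials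
  in the remaining coordinate (`facesTwo_gen_face00/01/10/11`); a representation on the open
  interval with a rational polynomial integrand lies in `relations ⊔ ⟨CubRep 1⟩`
  (`facesTwo_polyRep1_mem`: integrand additivity down to monomials `q · y^a`, which are cubical
  atoms of dimension one); registered sub-goal `stub_exactToFacesTwoAux2`.
* **The Stokes move** `facesTwo_stokes`: for two parameter sets `p₀`, `p₁` with `P + R + m ≥ 0`
  (boundedness on the closed square) and the face conditions, the hypothesis `hStokes` of the stub
  (= the landed `stub_boundedStokesMove`, Stokes on the open cube for bounded semialgebraic
  primitives) applied to `h = (GEN(p₀), GEN(p₁))` shows that every representation on the open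
  square whose integrand is `∂₀ GEN(p₀) + ∂₁ GEN(p₁)` there lies in the target subgroup.
* The calculus of the predicate "`g` is GOOD" = "every representation of `g` on the open square
  lies in `G`": congruence, zero, sums (`facesTwo_good_add3`).

References: M. Kontsevich, D. Zagier, *Periods* (2001), §1.2.
-/

noncomputable section

open MeasureTheory Set
open Literature.NumberTheory.Transcendental
open Literature.ModelTheory.ExponentialFields (IsSemialgebraic)

namespace Summit.KontsevichZagierPeriods.DihedralNormalForm.TameBVStokes

/-! ### The standing hypotheses

`hStokes` is verbatim the hypothesis of the stub (Stokes on the open cube for bounded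
semialgebraic primitives); `G` is the target subgroup, `hG : relations ≤ G`, and `hC1` says that
the cubical atoms `[(0,1), q y^a (1-y)^e]` of dimension one lie in `G`. -/

variable (hStokes : ∀ (k : ℕ) (h : Fin (k + 1) → (Fin (k + 1) → ℝ) → ℝ) (C : ℝ)
    (r : Literature.NumberTheory.Transcendental.KZ.IntegralRep (k + 1))
    (f₀ f₁ : Fin (k + 1) → Literature.NumberTheory.Transcendental.KZ.IntegralRep k),
    (∀ i, Literature.NumberTheory.Transcendental.IsSemialgebraicFunOn ℚ
      {x : Fin (k + 1) → ℝ | ∀ i, x i ∈ Set.Icc (0:ℝ) 1} (h i)) →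
    (∀ i, ∀ x ∈ {x : Fin (k + 1) → ℝ | ∀ i, x i ∈ Set.Ioo (0:ℝ) 1}, |h i x| ≤ C) →
    (∀ i, ∀ x ∈ {x : Fin (k + 1) → ℝ | ∀ i, x i ∈ Set.Ioo (0:ℝ) 1},
      DifferentiableAt ℝ (h i) x) →
    (∀ i, ∀ y ∈ {x : Fin k → ℝ | ∀ i, x i ∈ Set.Ioo (0:ℝ) 1},
      ContinuousOn (fun t : ℝ => h i (Fin.insertNth i t y)) (Set.Icc 0 1)) →
    r.domain = {x : Fin (k + 1) → ℝ | ∀ i, x i ∈ Set.Ioo (0:ℝ) 1} →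
    Set.EqOn r.integrand (fun x => ∑ i, fderiv ℝ (h i) x (Pi.single i 1)) r.domain →
    (∀ i, (f₀ i).domain = {x : Fin k → ℝ | ∀ i, x i ∈ Set.Ioo (0:ℝ) 1} ∧
      (f₁ i).domain = {x : Fin k → ℝ | ∀ i, x i ∈ Set.Ioo (0:ℝ) 1} ∧
      Set.EqOn (f₀ i).integrand (fun y => h i (Fin.insertNth i 0 y))
        {x : Fin k → ℝ | ∀ i, x i ∈ Set.Ioo (0:ℝ) 1} ∧
      Set.EqOn (f₁ i).integrand (fun y => h i (Fin.insertNth i 1 y))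
        {x : Fin k → ℝ | ∀ i, x i ∈ Set.Ioo (0:ℝ) 1}) →
    Literature.NumberTheory.Transcendental.KZ.of r -
        ∑ i, (Literature.NumberTheory.Transcendental.KZ.of (f₁ i) -
          Literature.NumberTheory.Transcendental.KZ.of (f₀ i)) ∈
      Literature.NumberTheory.Transcendental.KZ.relations)
  {G : AddSubgroup KZ.FormalRep} (hG : KZ.relations ≤ G)
  (hC1 : ∀ (f : KZ.IntegralRep 1) (q : ℚ) (a e : ℕ), f.domain = KZ.unitCube 1 →
    Set.EqOn f.integrand (fun y => (q : ℝ) * (y 0 ^ a * (1 - y 0) ^ e)) (KZ.unitCube 1) →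
    KZ.of f ∈ G)

/-! ### Face values of `GEN` -/

/-- The face `x₀ = 0`: `GEN (0, y) = (k·0^a) y^b (1-y)^R`. -/
theorem facesTwo_gen_face00 (k : ℚ) (a b P R : ℕ) (m : ℤ) (y : Fin 1 → ℝ) :
    (fun x : Fin 2 → ℝ => (k : ℝ) * (x 0 ^ a * x 1 ^ b * (1 - x 0) ^ P * (1 - x 1) ^ R *
      (1 - x 0 * x 1) ^ m)) (Fin.insertNth 0 (0:ℝ) y) =
      (Polynomial.aeval (y 0)
        (Polynomial.C (k * 0 ^ a) * Polynomial.X ^ b * (1 - Polynomial.X) ^ R) : ℝ) := by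
  simp only [(facesTwo_ins0 _ y).1, (facesTwo_ins0 _ y).2, map_mul, map_pow, map_sub, map_one,
    Polynomial.aeval_C, Polynomial.aeval_X, eq_ratCast]
  push_cast
  simp only [zero_mul, sub_zero, one_pow, one_zpow, mul_one]
  ring

/-- The face `x₀ = 1`: `GEN (1, y) = (k·0^P) y^b (1-y)^{R+m}` on the open interval, a polynomial
under the face condition `1 ≤ P ∨ 0 ≤ R + m`. -/
theorem facesTwo_gen_face01 (k : ℚ) (a b P R : ℕ) (m : ℤ) (hface : 1 ≤ P ∨ 0 ≤ (R : ℤ) + m)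
    {y : Fin 1 → ℝ} (hy : y ∈ KZ.unitCube 1) :
    (fun x : Fin 2 → ℝ => (k : ℝ) * (x 0 ^ a * x 1 ^ b * (1 - x 0) ^ P * (1 - x 1) ^ R *
      (1 - x 0 * x 1) ^ m)) (Fin.insertNth 0 (1:ℝ) y) =
      (Polynomial.aeval (y 0) (Polynomial.C (k * 0 ^ P) * Polynomial.X ^ b *
        (1 - Polynomial.X) ^ ((R : ℤ) + m).toNat) : ℝ) := by
  simp only [(facesTwo_ins0 _ y).1, (facesTwo_ins0 _ y).2, map_mul, map_pow, map_sub, map_one,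
    Polynomial.aeval_C, Polynomial.aeval_X, eq_ratCast]
  have hy1 : (1:ℝ) - y 0 ≠ 0 := by have := (hy 0).2; intro h; linarith
  rcases Nat.eq_zero_or_pos P with rfl | hP
  · have hRm : 0 ≤ (R : ℤ) + m := hface.resolve_left (by omega)
    have hN : (1 - y 0) ^ ((R : ℤ) + m).toNat = (1 - y 0) ^ R * (1 - y 0) ^ m := by
      rw [← zpow_natCast (1 - y 0) ((R : ℤ) + m).toNat, Int.toNat_of_nonneg hRm, zpow_add₀ hy1,
        zpow_natCast]
    rw [hN]
    push_cast
    simp only [one_pow, pow_zero, mul_one]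
    ring
  · obtain ⟨P', rfl⟩ : ∃ P', P = P' + 1 := ⟨P - 1, by omega⟩
    simp

/-- The face `x₁ = 0`: `GEN (y, 0) = (k·0^b) y^a (1-y)^P`. -/
theorem facesTwo_gen_face10 (k : ℚ) (a b P R : ℕ) (m : ℤ) (y : Fin 1 → ℝ) :
    (fun x : Fin 2 → ℝ => (k : ℝ) * (x 0 ^ a * x 1 ^ b * (1 - x 0) ^ P * (1 - x 1) ^ R *
      (1 - x 0 * x 1) ^ m)) (Fin.insertNth 1 (0:ℝ) y) =
      (Polynomial.aeval (y 0)
        (Polynomial.C (k * 0 ^ b) * Polynomial.X ^ a * (1 - Polynomial.X) ^ P) : ℝ) := by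
  simp only [(facesTwo_ins1 _ y).1, (facesTwo_ins1 _ y).2, map_mul, map_pow, map_sub, map_one,
    Polynomial.aeval_C, Polynomial.aeval_X, eq_ratCast]
  push_cast
  simp
  ring

/-- The face `x₁ = 1`: `GEN (y, 1) = (k·0^R) y^a (1-y)^{P+m}` on the open interval, a polynomial
under the face condition `1 ≤ R ∨ 0 ≤ P + m`. -/
theorem facesTwo_gen_face11 (k : ℚ) (a b P R : ℕ) (m : ℤ) (hface : 1 ≤ R ∨ 0 ≤ (P : ℤ) + m)
    {y : Fin 1 → ℝ} (hy : y ∈ KZ.unitCube 1) :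
    (fun x : Fin 2 → ℝ => (k : ℝ) * (x 0 ^ a * x 1 ^ b * (1 - x 0) ^ P * (1 - x 1) ^ R *
      (1 - x 0 * x 1) ^ m)) (Fin.insertNth 1 (1:ℝ) y) =
      (Polynomial.aeval (y 0) (Polynomial.C (k * 0 ^ R) * Polynomial.X ^ a *
        (1 - Polynomial.X) ^ ((P : ℤ) + m).toNat) : ℝ) := by
  simp only [(facesTwo_ins1 _ y).1, (facesTwo_ins1 _ y).2, map_mul, map_pow, map_sub, map_one,
    Polynomial.aeval_C, Polynomial.aeval_X, eq_ratCast]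
  have hy1 : (1:ℝ) - y 0 ≠ 0 := by have := (hy 0).2; intro h; linarith
  rcases Nat.eq_zero_or_pos R with rfl | hR
  · have hPm : 0 ≤ (P : ℤ) + m := hface.resolve_left (by omega)
    have hN : (1 - y 0) ^ ((P : ℤ) + m).toNat = (1 - y 0) ^ P * (1 - y 0) ^ m := by
      rw [← zpow_natCast (1 - y 0) ((P : ℤ) + m).toNat, Int.toNat_of_nonneg hPm, zpow_add₀ hy1,
        zpow_natCast]
    rw [hN]
    push_cast
    simp only [one_pow, pow_zero, mul_one]
    ring
  · obtain ⟨R', rfl⟩ : ∃ R', R = R' + 1 := ⟨R - 1, by omega⟩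
    simp

/-! ### Rational polynomials on the open interval -/

/-- A representation on the open interval with integrand a given rational polynomial in `y₀`. -/
theorem facesTwo_exists_polyRep1 (p : Polynomial ℚ) :
    ∃ f : KZ.IntegralRep 1, f.domain = KZ.unitCube 1 ∧
      f.integrand = fun y => (Polynomial.aeval (y 0) p : ℝ) := by
  have hsa : IsSemialgebraicFunOn ℚ (KZ.unitCube 1) fun y => (Polynomial.aeval (y 0) p : ℝ) := by
    refine (isSemialgebraicFunOn_aeval (KZ.isSemialgebraic_unitCube 1)
      (Polynomial.aeval (MvPolynomial.X 0 : MvPolynomial (Fin 1) ℚ) p)).congr fun y _ => ?_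
    show MvPolynomial.aeval y (Polynomial.aeval (MvPolynomial.X 0 : MvPolynomial (Fin 1) ℚ) p) =
      Polynomial.aeval (y 0) p
    rw [← Polynomial.aeval_algHom_apply, MvPolynomial.aeval_X]
  have hcont : Continuous fun y : Fin 1 → ℝ => (Polynomial.aeval (y 0) p : ℝ) :=
    (Polynomial.continuous_aeval p).comp (continuous_apply 0)
  exact ⟨⟨KZ.unitCube 1, _, KZ.isSemialgebraic_unitCube 1, hsa,
    KZ.integrableOn_unitCube_of_continuousOn hcont.continuousOn⟩, rfl, rfl⟩

include hG hC1 in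
/-- **A rational polynomial on the open interval lies in `relations ⊔ ⟨CubRep 1⟩`**: integrand
additivity down to the monomials `q·y^a = q·y^a(1-y)^0`, which are cubical atoms of dimension
one. [cite: KontsevichZagier2001, §1.2 rule (1)] -/
theorem facesTwo_polyRep1_mem : ∀ (p : Polynomial ℚ) (f : KZ.IntegralRep 1),
    f.domain = KZ.unitCube 1 →
      EqOn f.integrand (fun y => (Polynomial.aeval (y 0) p : ℝ)) (KZ.unitCube 1) → KZ.of f ∈ G := by
  intro p
  induction p using Polynomial.induction_on' with
  | add p q hp hq =>
    intro f hfd hfi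
    obtain ⟨f₁, h₁d, h₁i⟩ := facesTwo_exists_polyRep1 p
    obtain ⟨f₂, h₂d, h₂i⟩ := facesTwo_exists_polyRep1 q
    have hrel : KZ.of f - KZ.of f₁ - KZ.of f₂ ∈ KZ.relations := by
      refine KZ.integrandAddRel_subset_relations ⟨1, f, f₁, f₂, h₁d.trans hfd.symm,
        h₂d.trans hfd.symm, fun y hy => ?_, rfl⟩
      rw [hfd] at hy
      simp [hfi hy, h₁i, h₂i]
    have h₁ := hp f₁ h₁d (by rw [h₁i]; exact fun _ _ => rfl)
    have h₂ := hq f₂ h₂d (by rw [h₂i]; exact fun _ _ => rfl)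
    have e : KZ.of f = (KZ.of f - KZ.of f₁ - KZ.of f₂) + KZ.of f₁ + KZ.of f₂ := by abel
    rw [e]
    exact add_mem (add_mem (hG hrel) h₁) h₂
  | monomial n c =>
    intro f hfd hfi
    refine hC1 f c n 0 hfd fun y hy => ?_
    rw [hfi hy]
    simp [Polynomial.aeval_monomial]

/-! ### The Stokes move with `GEN` primitives -/

include hStokes hG hC1 in
/-- **The Stokes move of the stub.** For `h₀ = GEN(k₀, a₀, b₀, P₀, R₀, m₀)`,
`h₁ = GEN(k₁, a₁, b₁, P₁, R₁, m₁)` with `Pᵢ + Rᵢ + mᵢ ≥ 0` (so `|hᵢ| ≤ |kᵢ|` on the closed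
square) and the face conditions (so the four faces are rational polynomials), every
representation on the open square whose integrand is `∂₀h₀ + ∂₁h₁` there lies in `G`: the Stokes
hypothesis gives `[r] ≡ Σᵢ ([face¹ᵢ] − [face⁰ᵢ])`, and the faces lie in `relations ⊔ ⟨CubRep 1⟩`.
[cite: KontsevichZagier2001, §1.2 rule (3)] -/
theorem facesTwo_stokes (k₀ : ℚ) (a₀ b₀ P₀ R₀ : ℕ) (m₀ : ℤ) (k₁ : ℚ) (a₁ b₁ P₁ R₁ : ℕ) (m₁ : ℤ)
    (h₀ : 0 ≤ (P₀ : ℤ) + R₀ + m₀) (h₁ : 0 ≤ (P₁ : ℤ) + R₁ + m₁)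
    (hf₀ : 1 ≤ P₀ ∨ 0 ≤ (R₀ : ℤ) + m₀) (hf₁ : 1 ≤ R₁ ∨ 0 ≤ (P₁ : ℤ) + m₁)
    (r : KZ.IntegralRep 2) (hrd : r.domain = KZ.unitCube 2)
    (hri : ∀ x ∈ KZ.unitCube 2, r.integrand x =
      (((k₀ * a₀ : ℚ) : ℝ) * (x 0 ^ (a₀ - 1) * x 1 ^ b₀ * (1 - x 0) ^ P₀ * (1 - x 1) ^ R₀ *
          (1 - x 0 * x 1) ^ m₀) -
        ((k₀ * P₀ : ℚ) : ℝ) * (x 0 ^ a₀ * x 1 ^ b₀ * (1 - x 0) ^ (P₀ - 1) * (1 - x 1) ^ R₀ *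
          (1 - x 0 * x 1) ^ m₀) -
        ((k₀ * m₀ : ℚ) : ℝ) * (x 0 ^ a₀ * x 1 ^ (b₀ + 1) * (1 - x 0) ^ P₀ * (1 - x 1) ^ R₀ *
          (1 - x 0 * x 1) ^ (m₀ - 1))) +
      (((k₁ * b₁ : ℚ) : ℝ) * (x 0 ^ a₁ * x 1 ^ (b₁ - 1) * (1 - x 0) ^ P₁ * (1 - x 1) ^ R₁ *
          (1 - x 0 * x 1) ^ m₁) -
        ((k₁ * R₁ : ℚ) : ℝ) * (x 0 ^ a₁ * x 1 ^ b₁ * (1 - x 0) ^ P₁ * (1 - x 1) ^ (R₁ - 1) *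
          (1 - x 0 * x 1) ^ m₁) -
        ((k₁ * m₁ : ℚ) : ℝ) * (x 0 ^ (a₁ + 1) * x 1 ^ b₁ * (1 - x 0) ^ P₁ * (1 - x 1) ^ R₁ *
          (1 - x 0 * x 1) ^ (m₁ - 1)))) :
    KZ.of r ∈ G := by
  -- the four faces, rational polynomials in one variable
  obtain ⟨f₀₀, h₀₀d, h₀₀i⟩ := facesTwo_exists_polyRep1
    (Polynomial.C (k₀ * 0 ^ a₀) * Polynomial.X ^ b₀ * (1 - Polynomial.X) ^ R₀)
  obtain ⟨f₀₁, h₀₁d, h₀₁i⟩ := facesTwo_exists_polyRep1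
    (Polynomial.C (k₀ * 0 ^ P₀) * Polynomial.X ^ b₀ * (1 - Polynomial.X) ^ ((R₀ : ℤ) + m₀).toNat)
  obtain ⟨f₁₀, h₁₀d, h₁₀i⟩ := facesTwo_exists_polyRep1
    (Polynomial.C (k₁ * 0 ^ b₁) * Polynomial.X ^ a₁ * (1 - Polynomial.X) ^ P₁)
  obtain ⟨f₁₁, h₁₁d, h₁₁i⟩ := facesTwo_exists_polyRep1
    (Polynomial.C (k₁ * 0 ^ R₁) * Polynomial.X ^ a₁ * (1 - Polynomial.X) ^ ((P₁ : ℤ) + m₁).toNat)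
  have hmem₀₀ : KZ.of f₀₀ ∈ G :=
    facesTwo_polyRep1_mem hG hC1 _ f₀₀ h₀₀d (by rw [h₀₀i]; exact fun _ _ => rfl)
  have hmem₀₁ : KZ.of f₀₁ ∈ G :=
    facesTwo_polyRep1_mem hG hC1 _ f₀₁ h₀₁d (by rw [h₀₁i]; exact fun _ _ => rfl)
  have hmem₁₀ : KZ.of f₁₀ ∈ G :=
    facesTwo_polyRep1_mem hG hC1 _ f₁₀ h₁₀d (by rw [h₁₀i]; exact fun _ _ => rfl)
  have hmem₁₁ : KZ.of f₁₁ ∈ G :=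
    facesTwo_polyRep1_mem hG hC1 _ f₁₁ h₁₁d (by rw [h₁₁i]; exact fun _ _ => rfl)
  have hk₀ : |((k₀ : ℚ) : ℝ)| ≤ max |((k₀ : ℚ) : ℝ)| |((k₁ : ℚ) : ℝ)| := le_max_left _ _
  have hk₁ : |((k₁ : ℚ) : ℝ)| ≤ max |((k₀ : ℚ) : ℝ)| |((k₁ : ℚ) : ℝ)| := le_max_right _ _
  -- the Stokes hypothesis with `h = (GEN(p₀), GEN(p₁))`
  have hmain := hStokes 1
    ![fun x => (k₀ : ℝ) * (x 0 ^ a₀ * x 1 ^ b₀ * (1 - x 0) ^ P₀ * (1 - x 1) ^ R₀ *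
        (1 - x 0 * x 1) ^ m₀),
      fun x => (k₁ : ℝ) * (x 0 ^ a₁ * x 1 ^ b₁ * (1 - x 0) ^ P₁ * (1 - x 1) ^ R₁ *
        (1 - x 0 * x 1) ^ m₁)]
    (max |((k₀ : ℚ) : ℝ)| |((k₁ : ℚ) : ℝ)|) r ![f₀₀, f₁₀] ![f₀₁, f₁₁]
    (fun i => by
      fin_cases i
      · exact facesTwo_gen_sa_S2 k₀ a₀ b₀ P₀ R₀ m₀
      · exact facesTwo_gen_sa_S2 k₁ a₁ b₁ P₁ R₁ m₁)
    (fun i => by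
      fin_cases i
      · exact facesTwo_gen_abs_le_Q2 k₀ a₀ b₀ P₀ R₀ m₀ h₀ hk₀
      · exact facesTwo_gen_abs_le_Q2 k₁ a₁ b₁ P₁ R₁ m₁ h₁ hk₁)
    (fun i => by
      fin_cases i
      · exact fun x hx => facesTwo_gen_differentiableAt k₀ a₀ b₀ P₀ R₀ m₀ hx
      · exact fun x hx => facesTwo_gen_differentiableAt k₁ a₁ b₁ P₁ R₁ m₁ hx)
    (fun i => by
      fin_cases i
      · exact facesTwo_gen_continuousOn_fibre k₀ a₀ b₀ P₀ R₀ m₀ 0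
      · exact facesTwo_gen_continuousOn_fibre k₁ a₁ b₁ P₁ R₁ m₁ 1)
    hrd
    (by
      rw [hrd]
      intro x hx
      show r.integrand x = ∑ i : Fin 2, fderiv ℝ ((![fun x => (k₀ : ℝ) * (x 0 ^ a₀ * x 1 ^ b₀ *
          (1 - x 0) ^ P₀ * (1 - x 1) ^ R₀ * (1 - x 0 * x 1) ^ m₀),
        fun x => (k₁ : ℝ) * (x 0 ^ a₁ * x 1 ^ b₁ * (1 - x 0) ^ P₁ * (1 - x 1) ^ R₁ *
          (1 - x 0 * x 1) ^ m₁)] : Fin 2 → (Fin 2 → ℝ) → ℝ) i) x (Pi.single i 1)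
      rw [Fin.sum_univ_two]
      show r.integrand x = fderiv ℝ (fun x => (k₀ : ℝ) * (x 0 ^ a₀ * x 1 ^ b₀ * (1 - x 0) ^ P₀ *
          (1 - x 1) ^ R₀ * (1 - x 0 * x 1) ^ m₀)) x (Pi.single 0 1) +
        fderiv ℝ (fun x => (k₁ : ℝ) * (x 0 ^ a₁ * x 1 ^ b₁ * (1 - x 0) ^ P₁ * (1 - x 1) ^ R₁ *
          (1 - x 0 * x 1) ^ m₁)) x (Pi.single 1 1)
      rw [facesTwo_gen_fderiv0 k₀ a₀ b₀ P₀ R₀ m₀ hx, facesTwo_gen_fderiv1 k₁ a₁ b₁ P₁ R₁ m₁ hx]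
      exact hri x hx)
    (fun i => by
      fin_cases i
      · refine ⟨h₀₀d, h₀₁d, fun y _ => ?_, fun y hy => ?_⟩
        · show f₀₀.integrand y = (fun x : Fin 2 → ℝ => (k₀ : ℝ) * (x 0 ^ a₀ * x 1 ^ b₀ *
            (1 - x 0) ^ P₀ * (1 - x 1) ^ R₀ * (1 - x 0 * x 1) ^ m₀)) (Fin.insertNth 0 (0:ℝ) y)
          rw [h₀₀i]
          exact (facesTwo_gen_face00 k₀ a₀ b₀ P₀ R₀ m₀ y).symm
        · show f₀₁.integrand y = (fun x : Fin 2 → ℝ => (k₀ : ℝ) * (x 0 ^ a₀ * x 1 ^ b₀ *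
            (1 - x 0) ^ P₀ * (1 - x 1) ^ R₀ * (1 - x 0 * x 1) ^ m₀)) (Fin.insertNth 0 (1:ℝ) y)
          rw [h₀₁i]
          exact (facesTwo_gen_face01 k₀ a₀ b₀ P₀ R₀ m₀ hf₀ hy).symm
      · refine ⟨h₁₀d, h₁₁d, fun y _ => ?_, fun y hy => ?_⟩
        · show f₁₀.integrand y = (fun x : Fin 2 → ℝ => (k₁ : ℝ) * (x 0 ^ a₁ * x 1 ^ b₁ *
            (1 - x 0) ^ P₁ * (1 - x 1) ^ R₁ * (1 - x 0 * x 1) ^ m₁)) (Fin.insertNth 1 (0:ℝ) y)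
          rw [h₁₀i]
          exact (facesTwo_gen_face10 k₁ a₁ b₁ P₁ R₁ m₁ y).symm
        · show f₁₁.integrand y = (fun x : Fin 2 → ℝ => (k₁ : ℝ) * (x 0 ^ a₁ * x 1 ^ b₁ *
            (1 - x 0) ^ P₁ * (1 - x 1) ^ R₁ * (1 - x 0 * x 1) ^ m₁)) (Fin.insertNth 1 (1:ℝ) y)
          rw [h₁₁i]
          exact (facesTwo_gen_face11 k₁ a₁ b₁ P₁ R₁ m₁ hf₁ hy).symm)
  have hsum : ∑ i : Fin 2, (KZ.of ((![f₀₁, f₁₁] : Fin 2 → KZ.IntegralRep 1) i) -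
      KZ.of ((![f₀₀, f₁₀] : Fin 2 → KZ.IntegralRep 1) i)) ∈ G := by
    rw [Fin.sum_univ_two]
    exact add_mem (sub_mem hmem₀₁ hmem₀₀) (sub_mem hmem₁₁ hmem₁₀)
  have e : KZ.of r = (KZ.of r - ∑ i : Fin 2, (KZ.of ((![f₀₁, f₁₁] : Fin 2 → KZ.IntegralRep 1) i) -
      KZ.of ((![f₀₀, f₁₀] : Fin 2 → KZ.IntegralRep 1) i))) +
      ∑ i : Fin 2, (KZ.of ((![f₀₁, f₁₁] : Fin 2 → KZ.IntegralRep 1) i) -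
        KZ.of ((![f₀₀, f₁₀] : Fin 2 → KZ.IntegralRep 1) i)) := by abel
  rw [e]
  exact add_mem (hG hmain) hsum

/-! ### Bookkeeping modulo relations -/

include hG in
/-- **Congruence**: if ONE representation of `g` on the open square lies in `G ⊇ relations`, all
of them do. [cite: KontsevichZagier2001, §1.2 rule (1)] -/
theorem facesTwo_good_congr {g : (Fin 2 → ℝ) → ℝ} {r₀ : KZ.IntegralRep 2}
    (h₀d : r₀.domain = KZ.unitCube 2) (h₀i : EqOn r₀.integrand g (KZ.unitCube 2))
    (h₀ : KZ.of r₀ ∈ G) : ∀ r : KZ.IntegralRep 2, r.domain = KZ.unitCube 2 →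
      Set.EqOn r.integrand g (KZ.unitCube 2) → KZ.of r ∈ G := by
  intro r hrd hri
  have h : KZ.of r - KZ.of r₀ ∈ KZ.relations :=
    KZ.of_sub_of_mem_relations_of_eqOn (h₀d.trans hrd.symm) fun x hx => by
      rw [hrd] at hx
      rw [hri hx, h₀i hx]
  have e : KZ.of r = (KZ.of r - KZ.of r₀) + KZ.of r₀ := by abel
  rw [e]
  exact add_mem (hG h) h₀

include hG in
/-- A function vanishing on the open square is GOOD. -/
theorem facesTwo_good_of_eqOn_zero {g : (Fin 2 → ℝ) → ℝ} (h : ∀ x ∈ KZ.unitCube 2, g x = 0) :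
    ∀ r : KZ.IntegralRep 2, r.domain = KZ.unitCube 2 →
      Set.EqOn r.integrand g (KZ.unitCube 2) → KZ.of r ∈ G := fun r hrd hri =>
  hG (KZ.of_mem_relations_of_eqOn_zero r fun x hx => by
    rw [hrd] at hx
    rw [hri hx, h x hx]
    rfl)

include hG in
/-- **Three-term additivity**: if `g = d + g₁ + g₂` on the open square with `d`, `g₁`, `g₂`
representable and GOOD, then `g` is GOOD (iterated integrand additivity).
[cite: KontsevichZagier2001, §1.2 rule (1)] -/
theorem facesTwo_good_add3 {g d g₁ g₂ : (Fin 2 → ℝ) → ℝ}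
    (hd : ∀ r : KZ.IntegralRep 2, r.domain = KZ.unitCube 2 →
      Set.EqOn r.integrand d (KZ.unitCube 2) → KZ.of r ∈ G)
    (hg₁ : ∀ r : KZ.IntegralRep 2, r.domain = KZ.unitCube 2 →
      Set.EqOn r.integrand g₁ (KZ.unitCube 2) → KZ.of r ∈ G)
    (hg₂ : ∀ r : KZ.IntegralRep 2, r.domain = KZ.unitCube 2 →
      Set.EqOn r.integrand g₂ (KZ.unitCube 2) → KZ.of r ∈ G)
    (rd : ∃ r : KZ.IntegralRep 2, r.domain = KZ.unitCube 2 ∧ Set.EqOn r.integrand d (KZ.unitCube 2))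
    (r₁ : ∃ r : KZ.IntegralRep 2, r.domain = KZ.unitCube 2 ∧ Set.EqOn r.integrand g₁ (KZ.unitCube 2))
    (r₂ : ∃ r : KZ.IntegralRep 2, r.domain = KZ.unitCube 2 ∧ Set.EqOn r.integrand g₂ (KZ.unitCube 2))
    (heq : ∀ x ∈ KZ.unitCube 2, g x = d x + g₁ x + g₂ x) :
    ∀ r : KZ.IntegralRep 2, r.domain = KZ.unitCube 2 →
      Set.EqOn r.integrand g (KZ.unitCube 2) → KZ.of r ∈ G := by
  intro r hrd hri
  obtain ⟨Rd, hRd, hRi⟩ := rd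
  obtain ⟨R₁, hR₁d, hR₁i⟩ := r₁
  obtain ⟨R₂, hR₂d, hR₂i⟩ := r₂
  have hrel : KZ.of r - KZ.of Rd - ∑ i, KZ.of ((![R₁, R₂] : Fin 2 → KZ.IntegralRep 2) i) ∈
      KZ.relations := by
    refine KZ.of_sub_of_sub_sum_mem_relations 2 r Rd ![R₁, R₂] (hRd.trans hrd.symm)
      (fun i => by fin_cases i <;> simp [hR₁d, hR₂d, hrd]) fun x hx => ?_
    rw [hrd] at hx
    simp only [Fin.sum_univ_two, Matrix.cons_val_zero, Matrix.cons_val_one, Matrix.cons_val_fin_one]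
    rw [hri hx, heq x hx, hRi hx, hR₁i hx, hR₂i hx]
    ring
  have hsum : KZ.of Rd + ∑ i, KZ.of ((![R₁, R₂] : Fin 2 → KZ.IntegralRep 2) i) ∈ G := by
    rw [Fin.sum_univ_two]
    exact add_mem (hd Rd hRd hRi) (add_mem (hg₁ R₁ hR₁d hR₁i) (hg₂ R₂ hR₂d hR₂i))
  have e : KZ.of r = (KZ.of r - KZ.of Rd - ∑ i, KZ.of ((![R₁, R₂] : Fin 2 → KZ.IntegralRep 2) i)) +
      (KZ.of Rd + ∑ i, KZ.of ((![R₁, R₂] : Fin 2 → KZ.IntegralRep 2) i)) := by abel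
  rw [e]
  exact add_mem (hG hrel) hsum

include hG in
/-- **Two-term additivity**: `g = g₁ + g₂` on the open square with `g₁`, `g₂` representable and
GOOD makes `g` GOOD. [cite: KontsevichZagier2001, §1.2 rule (1)] -/
theorem facesTwo_good_add {g g₁ g₂ : (Fin 2 → ℝ) → ℝ}
    (hg₁ : ∀ r : KZ.IntegralRep 2, r.domain = KZ.unitCube 2 →
      Set.EqOn r.integrand g₁ (KZ.unitCube 2) → KZ.of r ∈ G)
    (hg₂ : ∀ r : KZ.IntegralRep 2, r.domain = KZ.unitCube 2 →
      Set.EqOn r.integrand g₂ (KZ.unitCube 2) → KZ.of r ∈ G)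
    (r₁ : ∃ r : KZ.IntegralRep 2, r.domain = KZ.unitCube 2 ∧ Set.EqOn r.integrand g₁ (KZ.unitCube 2))
    (r₂ : ∃ r : KZ.IntegralRep 2, r.domain = KZ.unitCube 2 ∧ Set.EqOn r.integrand g₂ (KZ.unitCube 2))
    (heq : ∀ x ∈ KZ.unitCube 2, g x = g₁ x + g₂ x) :
    ∀ r : KZ.IntegralRep 2, r.domain = KZ.unitCube 2 →
      Set.EqOn r.integrand g (KZ.unitCube 2) → KZ.of r ∈ G := by
  obtain ⟨z, hzd, hzi⟩ := KZ.exists_zeroRep (n := 2) (KZ.isSemialgebraic_unitCube 2)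
  refine facesTwo_good_add3 hG hg₁ hg₂ (facesTwo_good_of_eqOn_zero hG (g := fun _ => (0:ℝ))
    fun _ _ => rfl) r₁ r₂ ⟨z, hzd, fun x _ => by simp [hzi]⟩ fun x hx => ?_
  rw [heq x hx, add_zero]

/-! ### Registered sub-goal -/

/-- Registered sub-goal `stub_exactToFacesTwoAux2` of this file: rational polynomials in one
variable are integrands of representations on the open interval (`facesTwo_exists_polyRep1`). -/
theorem stub_exactToFacesTwoAux2 : ∀ p : Polynomial ℚ, ∃ f : Literature.NumberTheory.Transcendental.KZ.IntegralRep 1, f.domain = {x : Fin 1 → ℝ | ∀ i, x i ∈ Set.Ioo (0:ℝ) 1} ∧ f.integrand = fun y => (Polynomial.aeval (y 0) p : ℝ) :=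
  fun p => facesTwo_exists_polyRep1 p

end Summit.KontsevichZagierPeriods.DihedralNormalForm.TameBVStokes
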